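import Summits.QuantumFields.BalabanUV.T4Continuum.Spine.NE7.QLaBlockAvgPrintKind

/-!
# Spine/NE7/QLaBlockAvgTVDomain — NODE S's averaging-side certificates for the PRINTED (0.4) prescription `blockAvg expMeanLogSU` on
# `SU(N)` on a LEVEL-FREE domain family: the TOTAL-VARIATION balls `tv(1, V) ≤ τ⋆` with ONE constant radius at EVERY level
# (no shrink per level at all, no anchoring at the top level, no dependence on the torus exponent `m`)

Cell `pub-balaban-gaps` (YM blitz Y1, track G2, seat `ne7`, generation 14); text of record
`run/shared/lean/pub/pub-balaban-gaps/ne/NE7.md` (census row R82 of this generation).  Fifty-fifth `Spine/NE7/` file; 0 sorry;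
[folklore] bookkeeping over generation 8's one-step estimates (`QLaBlockAvgContraction.tv_framed_le`); imports file 51 (`theta_le_one`).

WHY.  NODE S consumes its holonomy ∕ loop-defect bounds ONLY for configurations that are trivial off a finite bond set `Λ` with one-bond
deviations `≤ Dm` (the (1.100)-type inserts of one renormalised component: files 36 ∕ 40–44 ∕ 47–50, `hoff` ∕ `hD`).  For such a
configuration the natural size is its TOTAL VARIATION from the flat one, `tv(1, V) = Σ_b dist1 V_b ≤ |Λ|·Dm` — not a sup-radius.  The
domain families used so far are SUP-balls: generation 8's `dom` (shrinking by `16ℓ` per level), this generation's print-kind `domPK`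
(file 51, shrinking by `L` per level; both anchored at the global top level `m + K`, hence a factor `L^{−m}` at the unit lattice).
They shrink because a sup-ball must absorb the WORST-CASE one-step sup growth `L·ρ` (coherent deviations along whole segments).  A
total-variation ball needs no such provision: generation 8's own one-step estimate reads `tv(1, F(V)) ≤ (θ + K₁·ρ)·tv(1, V)` for ANY
sup-bound `ρ` of `V`, and `ρ := tv(1, V)` is one (`dist1 V_b ≤ tv(1, V)`), so `tv(1, F(V)) ≤ (θ + K₁·tv(1,V))·tv(1,V) ≤ tv(1,V)` as soon
as `θ + K₁·tv(1,V) ≤ 1` — the tv-ball of ANY radius `τ ≤ (1 − θ)∕K₁` (within the guards of the printed `log`) is mapped INTO ITSELF by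
the framed step, at every level, with the same radius (§2).  Along a trajectory the sizes then decay geometrically, `tv_i ≤ e·θ^i·tv₀`
(§3: the step factors `θ + K₁·tv_i` compose to `≤ e·θⁿ` because `Σ_i K₁·tv_i∕θ ≤ e·K₁tv₀∕(θ(1−θ)) ≤ 1` — a bootstrap on the
trajectory, not on the domain), and generation 4's shapes follow on the CONSTANT family `domTV τ⋆ j := {V | tv(1,V) ≤ τ⋆}`,
`τ⋆ = min(ρ⋆∕e, θ(1−θ)∕(eK₁))` (§4): `BondDevBound` ∕ `HolDevBound` (constant `e`, rate `θ = L^{1−d}`), `LoopDefectBound` (`e²∕2`),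
and the headline's one-level class form (§5).  For NODE S's consumers the domain hypothesis becomes `|Λ|·Dm ≤ τ⋆` — LEVEL-FREE and
VOLUME-FREE (§4 `mem_domTV_of_support`).

WHAT THIS CHANGES IN THE CENSUS (words unchanged, R10): the «format artifact `L^{−m}`» of files 51 ∕ 52 (census R80 (iv)) is NOT
intrinsic to NODE S's input: on total-variation balls there is no anchoring and no per-level shrink.  What it does NOT change: the SIZE
of the admissible inserts is still set by generation 8's non-optimal second-order constants (`τ⋆ = min(ρ⋆∕e, θ(1−θ)∕(eK₁))`,
`K₁ = 872dℓ²`; at `(4,3)`: `τ⋆ = ρ⋆∕e ≈ 2.2·10⁻⁹`), against the (1.100) inserts' `|X|·O(1)M²NR_k⁴ε_k` ([Balaban1989LargeFieldI] p. 196) — constant-vs-polylog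
stays row NE1′'s ∕ NODE 00's (β) (census R44 ∕ R46); components violating `|Λ|·Dm ≤ τ⋆` (young or large) need the object node's
trivial range bound.  NOT claimed: NE1a-STEP (two configurations), Bałaban's (52)∕(158) verbatim, the two-level prescription (sequel),
densities ∕ `R` ∕ (1.100).  (QL-a) NOT IN PRINT; NE7 NOT proved; spine 0∕9; one fixed finite T⁴ — NOT ℝ⁴, NOT infinite volume, NOT a
mass gap, NOT Clay.
-/

noncomputable section
open Finset
open scoped BigOperators Matrix Matrix.Norms.L2Operator

namespace Summit.QuantumFields.BalabanUV.T4Continuum.Spine.NE7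

open Literature.MathematicalPhysics.QuantumFieldTheory.Balaban1983to89
open Literature.MathematicalPhysics.QuantumFieldTheory.Balaban1983to89.T4Continuum
open Literature.MathematicalPhysics.QuantumFieldTheory.Balaban1983to89.T4AvgSensitivity
open Literature.MathematicalPhysics.QuantumFieldTheory.Balaban1983to89.T4AvgDerivBound
open Literature.MathematicalPhysics.QuantumFieldTheory.Balaban1983to89.BlockAveraging (Idx off blockAvg)
open ExpMeanLog

section SUN

variable {n : Type*} [Fintype n] [DecidableEq n] [Nonempty n]
variable {P : Params} {j : ℕ}

/-! ## §1 The total variation dominates every one-bond deviation; step factors compose under a summable budget -/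

/-- A one-bond deviation is at most the total variation from the flat configuration. [folklore] -/
theorem dist1_le_tv_one (V : GaugeField P j (Matrix.specialUnitaryGroup n ℂ)) (b : PBond P j) : dist1 (V b) ≤ tv 1 V := by
  rw [tv_one_eq V]
  exact Finset.single_le_sum (fun c _ => GaugeGroup.dist1_nonneg (V c)) (Finset.mem_univ b)

/-- `∏_{i<n'} (θ + x_i) ≤ θ^{n'}·exp(Σ_{i<n'} x_i∕θ)` for `θ > 0`, `x_i ≥ 0` (`θ + x ≤ θ·e^{x∕θ}`). [folklore] -/
theorem prod_add_le_pow_mul_exp {θ : ℝ} (hθ : 0 < θ) (x : ℕ → ℝ) (hx : ∀ i, 0 ≤ x i) (n' : ℕ) :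
    ∏ i ∈ range n', (θ + x i) ≤ θ ^ n' * Real.exp (∑ i ∈ range n', x i / θ) := by
  have hfac : ∀ i ∈ range n', θ + x i ≤ θ * Real.exp (x i / θ) := fun i _ => by
    have h1 := Real.add_one_le_exp (x i / θ)
    have e : θ * (x i / θ + 1) = θ + x i := by field_simp; ring
    calc θ + x i = θ * (x i / θ + 1) := e.symm
      _ ≤ θ * Real.exp (x i / θ) := mul_le_mul_of_nonneg_left h1 hθ.le
  calc ∏ i ∈ range n', (θ + x i) ≤ ∏ i ∈ range n', θ * Real.exp (x i / θ) :=
        Finset.prod_le_prod (fun i _ => add_nonneg hθ.le (hx i)) hfac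
    _ = θ ^ n' * Real.exp (∑ i ∈ range n', x i / θ) := by
        rw [Finset.prod_mul_distrib, Finset.prod_const, Finset.card_range, Real.exp_sum]

/-! ## §2 The total-variation radius and the one framed step at the configuration's OWN size -/

/-- THE TOTAL-VARIATION RADIUS `τ⋆ = min(ρ⋆∕e, θ(1−θ)∕(eK₁))` — ONE constant for all levels: `ρ⋆∕e` keeps every trajectory (sizes
`≤ e·τ⋆ ≤ ρ⋆`) inside the guards of the printed `log`; `θ(1−θ)∕(eK₁)` makes the step factors compose to `≤ e·θⁿ`. [folklore] -/
def tauStar (P : Params) (n : Type*) [Fintype n] : ℝ :=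
  min (radStar P n / Real.exp 1) (theta P * (1 - theta P) / (Real.exp 1 * K1 P))

/-- THE LEVEL-FREE DOMAIN FAMILY: total-variation balls `tv(1, V) ≤ τ⋆` (the same set description at every level `j`). [folklore] -/
def domTV (P : Params) (n : Type*) [Fintype n] [DecidableEq n] [Nonempty n] (j : ℕ) :
    Set (GaugeField P j (Matrix.specialUnitaryGroup n ℂ)) :=
  {V | tv 1 V ≤ tauStar P n}

/-- `0 ≤ τ⋆`. [folklore] -/
theorem tauStar_nonneg (P : Params) (n : Type*) [Fintype n] [Nonempty n] : 0 ≤ tauStar P n := by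
  have := radStar_pos P n; have := theta_pos P; have := theta_le_one P; have := K1_pos P
  have := Real.exp_pos (1 : ℝ)
  unfold tauStar
  refine le_min (by positivity) (div_nonneg (mul_nonneg (by positivity) (by linarith)) (by positivity))

/-- `e·τ⋆ ≤ ρ⋆` and `e·K₁·τ⋆ ≤ θ(1−θ)`. [folklore] -/
theorem tauStar_le (P : Params) (n : Type*) [Fintype n] [Nonempty n] :
    Real.exp 1 * tauStar P n ≤ radStar P n ∧ Real.exp 1 * K1 P * tauStar P n ≤ theta P * (1 - theta P) := by
  have hK := K1_pos P
  have he := Real.exp_pos (1 : ℝ)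
  have h1 := min_le_left (radStar P n / Real.exp 1) (theta P * (1 - theta P) / (Real.exp 1 * K1 P))
  have h2 := min_le_right (radStar P n / Real.exp 1) (theta P * (1 - theta P) / (Real.exp 1 * K1 P))
  constructor
  · calc Real.exp 1 * tauStar P n ≤ Real.exp 1 * (radStar P n / Real.exp 1) := mul_le_mul_of_nonneg_left h1 he.le
      _ = radStar P n := by field_simp
  · calc Real.exp 1 * K1 P * tauStar P n ≤ Real.exp 1 * K1 P * (theta P * (1 - theta P) / (Real.exp 1 * K1 P)) :=
          mul_le_mul_of_nonneg_left h2 (by positivity)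
      _ = theta P * (1 - theta P) := by field_simp

/-- The guards along a trajectory: for any size `s ≤ e·τ⋆` (`≤ ρ⋆`), `ℓ·s < δ_N` and `ℓ·s ≤ ½` (generation 8's top-radius guard).
[folklore] -/
theorem guards_of_le_exp_tauStar (P : Params) (n : Type*) [Fintype n] [Nonempty n] {s : ℝ} (hs : s ≤ Real.exp 1 * tauStar P n) :
    ell P * s < deltaSU n ∧ ell P * s ≤ 1 / 2 := by
  have hℓ := ell_pos P
  have hδ : 0 < deltaSU n := deltaSU_pos
  have hδ3 : deltaSU n ≤ 1 / 3 := min_le_left _ _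
  have hsr : s ≤ radStar P n := hs.trans (tauStar_le P n).1
  have h1 : ell P * s ≤ deltaSU n / 4 := by
    calc ell P * s ≤ ell P * (deltaSU n / (4 * ell P)) := mul_le_mul_of_nonneg_left (hsr.trans (min_le_left _ _)) hℓ.le
      _ = deltaSU n / 4 := by field_simp
  exact ⟨by linarith, by linarith⟩

/-- **THE FRAMED STEP AT THE CONFIGURATION's OWN SIZE**: if `tv(1, V) ≤ e·τ⋆` then `tv(1, F(V)) ≤ (θ + K₁·tv(1,V))·tv(1,V)` —
generation 8's `tv_framed_le` with the sup-bound `ρ := tv(1, V)` (§1). [folklore] -/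
theorem tv_framed_le_self (hj : j + 1 ≤ P.m + P.K) (V : GaugeField P j (Matrix.specialUnitaryGroup n ℂ))
    (hV : tv 1 V ≤ Real.exp 1 * tauStar P n) : tv 1 (framed V) ≤ (theta P + K1 P * tv 1 V) * tv 1 V := by
  obtain ⟨hδ, h2⟩ := guards_of_le_exp_tauStar P n hV
  have := tv_framed_le hj V (tv_nonneg 1 V) (dist1_le_tv_one V) hδ h2
  simpa only [K1, mul_assoc] using this

/-- **THE TV-BALL OF RADIUS `τ⋆` IS MAPPED INTO ITSELF** by the framed step, at every level (`θ + K₁τ⋆ ≤ 1`). [folklore] -/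
theorem tv_framed_le_tauStar (hj : j + 1 ≤ P.m + P.K) (V : GaugeField P j (Matrix.specialUnitaryGroup n ℂ))
    (hV : tv 1 V ≤ tauStar P n) : tv 1 (framed V) ≤ tauStar P n := by
  have hτ0 := tauStar_nonneg P n
  have hθ0 := theta_pos P
  have hθ1 := theta_le_one P
  have hK := K1_pos P
  have he1 : 1 ≤ Real.exp 1 := Real.one_le_exp zero_le_one
  obtain ⟨_, h3⟩ := tauStar_le P n
  have htv0 := tv_nonneg 1 V
  -- `K₁·tv ≤ K₁·τ⋆ ≤ e·K₁·τ⋆ ≤ θ(1−θ) ≤ 1 − θ`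
  have hK1 : K1 P * tv 1 V ≤ 1 - theta P := by
    have a : K1 P * tv 1 V ≤ K1 P * tauStar P n := mul_le_mul_of_nonneg_left hV hK.le
    have b : K1 P * tauStar P n ≤ Real.exp 1 * K1 P * tauStar P n := by
      have : 0 ≤ K1 P * tauStar P n := by positivity
      nlinarith
    nlinarith
  have hfac : theta P + K1 P * tv 1 V ≤ 1 := by linarith
  have hVe : tv 1 V ≤ Real.exp 1 * tauStar P n := hV.trans (by nlinarith)
  calc tv 1 (framed V) ≤ (theta P + K1 P * tv 1 V) * tv 1 V := tv_framed_le_self hj V hVe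
    _ ≤ 1 * tauStar P n := mul_le_mul hfac hV htv0 zero_le_one
    _ = tauStar P n := one_mul _

/-! ## §3 The trajectory bootstrap: framed descent with geometrically decaying sizes -/

/-- The budget: `Σ_{i<n'} K₁·(e·θ^i·τ)∕θ ≤ 1` for `0 ≤ τ ≤ τ⋆` (`Σ θ^i ≤ 1∕(1−θ)` and `e·K₁·τ⋆ ≤ θ(1−θ)`). [folklore] -/
theorem budget_le_one (P : Params) (n : Type*) [Fintype n] [Nonempty n] {τ : ℝ} (hτ0 : 0 ≤ τ) (hτ : τ ≤ tauStar P n) (n' : ℕ) :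
    ∑ i ∈ range n', K1 P * (Real.exp 1 * theta P ^ i * τ) / theta P ≤ 1 := by
  have hθ0 := theta_pos P
  have hθ1 := theta_le_one P
  have hK := K1_pos P
  have he := Real.exp_pos (1 : ℝ)
  obtain ⟨_, h3⟩ := tauStar_le P n
  have h3' : Real.exp 1 * K1 P * τ ≤ theta P * (1 - theta P) :=
    (mul_le_mul_of_nonneg_left hτ (by positivity)).trans h3
  have hre : ∑ i ∈ range n', K1 P * (Real.exp 1 * theta P ^ i * τ) / theta P
      = Real.exp 1 * K1 P * τ / theta P * ∑ i ∈ range n', theta P ^ i := by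
    rw [Finset.mul_sum]
    exact Finset.sum_congr rfl fun i _ => by ring
  rw [hre]
  have hsum0 : 0 ≤ ∑ i ∈ range n', theta P ^ i := Finset.sum_nonneg fun i _ => pow_nonneg hθ0.le i
  rcases eq_or_lt_of_le hθ1 with h1 | h1
  · -- `θ = 1` forces `τ = 0`
    have hτz : Real.exp 1 * K1 P * τ ≤ 0 := by rw [h1] at h3'; simpa using h3'
    have hτ0' : τ = 0 := le_antisymm (by nlinarith [mul_pos he hK]) hτ0
    simp [hτ0']
  · have h1θ : 0 < 1 - theta P := by linarith
    have hS : (1 - theta P) * ∑ i ∈ range n', theta P ^ i ≤ 1 := by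
      rw [mul_neg_geom_sum]; linarith [pow_nonneg hθ0.le n']
    have hSle : ∑ i ∈ range n', theta P ^ i ≤ 1 / (1 - theta P) := by
      rw [le_div_iff₀ h1θ, mul_comm]; exact hS
    have hcoef : Real.exp 1 * K1 P * τ / theta P ≤ 1 - theta P := by
      rw [div_le_iff₀ hθ0]; linarith
    calc Real.exp 1 * K1 P * τ / theta P * ∑ i ∈ range n', theta P ^ i
        ≤ (1 - theta P) * (1 / (1 - theta P)) := mul_le_mul hcoef hSle hsum0 h1θ.le
      _ = 1 := mul_one_div_cancel h1θ.ne'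

/-- **FRAMED DESCENT WITH TRAJECTORY-DEPENDENT FACTORS** (generic in the gauge group and the averaging family; the analogue of file
25's `framedDescent`): if ONE framed step taken at the configuration's own size contracts total variation by `θ + K·tv` whenever the
size is `≤ e·τ` (`hstep`), and the budget `Σ_{i<n} K·(e·θ^i·tv₀)∕θ ≤ 1` holds for the start size `tv₀ = tv(1,V) ≤ τ` (`hbudget`), then
after `n` steps there is a frame `u` of `T^{(k+n)}` with `tv(1, (avgⁿ V)^u) ≤ (∏_{i<n}(θ + K·e·θ^i·tv₀))·tv₀` — each step is taken at the
current size, which the product so far bounds by `e·θ^i·tv₀`; the frames are pushed up by covariance ([Balaban1985Averaging] (11)).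
[folklore] -/
theorem tvDescent_of_step {G : Type*} [GaugeGroup G] {av : ∀ j, Averaging P j G} {θ K τ : ℝ} (hθ : 0 < θ) (hθ1 : θ ≤ 1)
    (hK : 0 ≤ K) (hτ : 0 ≤ τ)
    (hstep : ∀ j, j + 1 ≤ P.m + P.K → ∀ W : GaugeField P j G, tv 1 W ≤ Real.exp 1 * τ →
      ∃ u : GaugeTransf P (j + 1) G, tv 1 (GaugeField.gaugeAct u ((av j).avg W)) ≤ (θ + K * tv 1 W) * tv 1 W)
    {k : ℕ} (V : GaugeField P k G) (hV : tv 1 V ≤ τ)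
    (hbudget : ∀ n' : ℕ, ∑ i ∈ range n', K * (Real.exp 1 * θ ^ i * tv 1 V) / θ ≤ 1) :
    ∀ n' : ℕ, k + n' ≤ P.m + P.K →
      ∃ u : GaugeTransf P (k + n') G,
        tv 1 (GaugeField.gaugeAct u (iterFrom av k n' V)) ≤ (∏ i ∈ range n', (θ + K * (Real.exp 1 * θ ^ i * tv 1 V))) * tv 1 V
  | 0, _ => by
    refine ⟨fun _ => 1, ?_⟩
    have : GaugeField.gaugeAct (fun _ => (1 : G)) (iterFrom av k 0 V) = V := by
      funext b; simp [GaugeField.gaugeAct]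
    rw [this]; simp
  | n' + 1, hn => by
    obtain ⟨u, htv⟩ := tvDescent_of_step hθ hθ1 hK hτ hstep V hV hbudget n' (by omega)
    have htv0 := tv_nonneg 1 V
    have he := Real.exp_pos (1 : ℝ)
    -- the product so far is ≤ e·θ^{n'}
    have hprod : ∏ i ∈ range n', (θ + K * (Real.exp 1 * θ ^ i * tv 1 V)) ≤ Real.exp 1 * θ ^ n' := by
      refine (prod_add_le_pow_mul_exp hθ (fun i => K * (Real.exp 1 * θ ^ i * tv 1 V)) (fun i => by positivity) n').trans ?_
      rw [mul_comm]
      exact mul_le_mul_of_nonneg_right (Real.exp_le_exp.mpr (hbudget n')) (pow_nonneg hθ.le _)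
    -- current size
    have hWsize : tv 1 (GaugeField.gaugeAct u (iterFrom av k n' V)) ≤ Real.exp 1 * θ ^ n' * tv 1 V :=
      htv.trans (mul_le_mul_of_nonneg_right hprod htv0)
    have hWe : tv 1 (GaugeField.gaugeAct u (iterFrom av k n' V)) ≤ Real.exp 1 * τ := by
      refine hWsize.trans ?_
      have h1 : θ ^ n' ≤ 1 := pow_le_one₀ hθ.le hθ1
      have h2 : Real.exp 1 * θ ^ n' * tv 1 V ≤ Real.exp 1 * 1 * tv 1 V := by gcongr
      have h3 : Real.exp 1 * 1 * tv 1 V ≤ Real.exp 1 * τ := by nlinarith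
      linarith
    -- one framed step at the current size, frames composed by covariance
    obtain ⟨u', hu'⟩ := hstep (k + n') (by omega) _ hWe
    have key : (GaugeField.gaugeAct (fun y => u' y * u (emb y)) ((av (k + n')).avg (iterFrom av k n' V)) : GaugeField P (k + n' + 1) G)
        = GaugeField.gaugeAct u' ((av (k + n')).avg (GaugeField.gaugeAct u (iterFrom av k n' V))) := by
      rw [(av (k + n')).covariant (by omega) u (iterFrom av k n' V)]
      funext c
      simp only [GaugeField.gaugeAct, mul_inv_rev, mul_assoc]
    refine ⟨fun y => u' y * u (emb y), ?_⟩
    show tv (1 : GaugeField P (k + n' + 1) G)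
        (GaugeField.gaugeAct (fun y => u' y * u (emb y)) ((av (k + n')).avg (iterFrom av k n' V)))
        ≤ (∏ i ∈ range (n' + 1), (θ + K * (Real.exp 1 * θ ^ i * tv 1 V))) * tv 1 V
    rw [key, Finset.prod_range_succ]
    refine hu'.trans ?_
    have hfacW : θ + K * tv 1 (GaugeField.gaugeAct u (iterFrom av k n' V)) ≤ θ + K * (Real.exp 1 * θ ^ n' * tv 1 V) := by
      nlinarith [mul_le_mul_of_nonneg_left hWsize hK]
    have hposW : 0 ≤ θ + K * tv 1 (GaugeField.gaugeAct u (iterFrom av k n' V)) :=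
      add_nonneg hθ.le (mul_nonneg hK (tv_nonneg 1 _))
    calc (θ + K * tv 1 (GaugeField.gaugeAct u (iterFrom av k n' V))) * tv 1 (GaugeField.gaugeAct u (iterFrom av k n' V))
        ≤ (θ + K * (Real.exp 1 * θ ^ n' * tv 1 V)) * ((∏ i ∈ range n', (θ + K * (Real.exp 1 * θ ^ i * tv 1 V))) * tv 1 V) :=
          mul_le_mul hfacW htv (tv_nonneg 1 _) (hposW.trans hfacW)
      _ = (∏ i ∈ range n', (θ + K * (Real.exp 1 * θ ^ i * tv 1 V))) * (θ + K * (Real.exp 1 * θ ^ n' * tv 1 V)) * tv 1 V := by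
          ring

/-- **THE FRAMED STEP OF (0.4) AT THE CURRENT SIZE, AS A STEP HYPOTHESIS** (`tv_framed_le_self` with the frame `frameTransf`). [folklore] -/
theorem tvStep_blockAvgSU (j : ℕ) (hj : j + 1 ≤ P.m + P.K) (W : GaugeField P j (Matrix.specialUnitaryGroup n ℂ))
    (hW : tv 1 W ≤ Real.exp 1 * tauStar P n) :
    ∃ u : GaugeTransf P (j + 1) (Matrix.specialUnitaryGroup n ℂ),
      tv 1 (GaugeField.gaugeAct u (((fun j => (blockAvg (expMeanLogSU (n := n)) :
        Averaging P j (Matrix.specialUnitaryGroup n ℂ))) j).avg W)) ≤ (theta P + K1 P * tv 1 W) * tv 1 W :=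
  ⟨frameTransf W, by
    show tv 1 (framed W) ≤ (theta P + K1 P * tv 1 W) * tv 1 W
    exact tv_framed_le_self hj W hW⟩

/-- **GEOMETRIC DECAY OF THE SIZES FOR (0.4) ON `SU(N)`**: `tv(1, (avgⁿ V)^u) ≤ e·θⁿ·tv(1, V)` for a suitable frame `u`, whenever
`tv(1, V) ≤ τ⋆`. [folklore] -/
theorem exists_frame_tv_le {k n' : ℕ} (hn : k + n' ≤ P.m + P.K) (V : GaugeField P k (Matrix.specialUnitaryGroup n ℂ))
    (hV : tv 1 V ≤ tauStar P n) :
    ∃ u : GaugeTransf P (k + n') (Matrix.specialUnitaryGroup n ℂ),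
      tv 1 (GaugeField.gaugeAct u (iterFrom (fun j => (blockAvg (expMeanLogSU (n := n)) :
          Averaging P j (Matrix.specialUnitaryGroup n ℂ))) k n' V)) ≤ Real.exp 1 * theta P ^ n' * tv 1 V := by
  have hθ0 := theta_pos P
  have hb : ∀ m' : ℕ, ∑ i ∈ range m', K1 P * (Real.exp 1 * theta P ^ i * tv 1 V) / theta P ≤ 1 :=
    fun m' => budget_le_one P n (tv_nonneg 1 V) hV m'
  obtain ⟨u, hu⟩ := tvDescent_of_step hθ0 (theta_le_one P) (K1_pos P).le (tauStar_nonneg P n)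
    (fun j hj W hW => tvStep_blockAvgSU j hj W hW) V hV hb n' hn
  refine ⟨u, hu.trans (mul_le_mul_of_nonneg_right ?_ (tv_nonneg 1 V))⟩
  refine (prod_add_le_pow_mul_exp hθ0 (fun i => K1 P * (Real.exp 1 * theta P ^ i * tv 1 V)) (fun i => ?_) n').trans ?_
  · have := K1_pos P; have := tv_nonneg 1 V; have := Real.exp_pos (1:ℝ); positivity
  · rw [mul_comm]
    exact mul_le_mul_of_nonneg_right (Real.exp_le_exp.mpr (hb n')) (pow_nonneg hθ0.le _)

/-! ## §4 `BondDevBound`, `HolDevBound`, `LoopDefectBound` on the level-free family -/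

/-- The trivial configuration is in every tv-ball. [folklore] -/
theorem one_mem_domTV (j : ℕ) : (1 : GaugeField P j (Matrix.specialUnitaryGroup n ℂ)) ∈ domTV P n j := by
  show tv (1 : GaugeField P j (Matrix.specialUnitaryGroup n ℂ)) 1 ≤ tauStar P n
  rw [tv_one_eq]
  simp only [show ∀ b, (1 : GaugeField P j (Matrix.specialUnitaryGroup n ℂ)) b = 1 from fun _ => rfl, GaugeGroup.dist1_one,
    Finset.sum_const_zero]
  exact tauStar_nonneg P n

/-- **THE CONSUMERS' FORM OF THE DOMAIN HYPOTHESIS**: a configuration trivial off a finite bond set `Λ` with one-bond deviations `≤ Dm`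
on `Λ` lies in the tv-ball as soon as `|Λ|·Dm ≤ τ⋆` — level-free, volume-free. [folklore] -/
theorem mem_domTV_of_support {V : GaugeField P j (Matrix.specialUnitaryGroup n ℂ)} (Λ : Finset (PBond P j)) {Dm : ℝ}
    (hoff : ∀ b, b ∉ Λ → V b = 1) (hDm : ∀ b ∈ Λ, dist1 (V b) ≤ Dm) (hΛ : (Λ.card : ℝ) * Dm ≤ tauStar P n) :
    V ∈ domTV P n j := by
  show tv 1 V ≤ tauStar P n
  classical
  rw [tv_one_eq]
  have hsplit : ∑ b : PBond P j, dist1 (V b) = ∑ b ∈ Λ, dist1 (V b) := by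
    refine (Finset.sum_subset (Finset.subset_univ Λ) fun b _ hb => ?_).symm
    rw [hoff b hb, GaugeGroup.dist1_one]
  rw [hsplit]
  refine le_trans ?_ hΛ
  calc ∑ b ∈ Λ, dist1 (V b) ≤ ∑ _b ∈ Λ, Dm := Finset.sum_le_sum fun b hb => hDm b hb
    _ = (Λ.card : ℝ) * Dm := by rw [Finset.sum_const, nsmul_eq_mul]

/-- **`BondDevBound (blockAvg expMeanLogSU) domTV e θ`**, `θ = L^{1−d}` — generation 4's per-coarse-bond shape for the printed
prescription on `SU(N)` ON THE LEVEL-FREE TV-BALLS. [folklore] -/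
theorem bondDevBound_blockAvgSU_tv :
    BondDevBound (fun j => (blockAvg (expMeanLogSU (n := n)) : Averaging P j (Matrix.specialUnitaryGroup n ℂ))) (domTV P n)
      (Real.exp 1) (theta P) := by
  intro k n' hn V hV _
  obtain ⟨u, htv⟩ := exists_frame_tv_le hn V hV
  refine ⟨u, fun c => (bdist_le_tv 1 _ c).trans ?_⟩
  calc tv 1 (GaugeField.gaugeAct u (iterFrom (fun j => (blockAvg (expMeanLogSU (n := n)) :
          Averaging P j (Matrix.specialUnitaryGroup n ℂ))) k n' V)) ≤ Real.exp 1 * theta P ^ n' * tv 1 V := htv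
    _ = Real.exp 1 * (tv 1 V * theta P ^ n') := by ring

/-- **`HolDevBound (blockAvg expMeanLogSU) domTV e θ`** — NODE S's holonomy-level input (file 8) on the level-free tv-balls. [folklore] -/
theorem holDevBound_blockAvgSU_tv :
    HolDevBound (fun j => (blockAvg (expMeanLogSU (n := n)) : Averaging P j (Matrix.specialUnitaryGroup n ℂ))) (domTV P n)
      (Real.exp 1) (theta P) :=
  holDevBound_of_bondDevBound bondDevBound_blockAvgSU_tv

/-- **`LoopDefectBound (blockAvg expMeanLogSU) domTV (e²/2) θ`** — generation 3's second-order loop-defect bound on the level-free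
tv-balls (criticality `reTrCrit_specialUnitaryGroup`). [folklore] -/
theorem loopDefectBound_blockAvgSU_tv :
    LoopDefectBound (fun j => (blockAvg (expMeanLogSU (n := n)) : Averaging P j (Matrix.specialUnitaryGroup n ℂ))) (domTV P n)
      (1 / 2 * Real.exp 1 ^ 2) (theta P) :=
  loopDefectBound_of_holDevBound reTrCrit_specialUnitaryGroup (by norm_num) holDevBound_blockAvgSU_tv

end SUN

/-! ## §5 The headline's one-level printed class on the level-free family -/

section Headline

open Literature.MathematicalPhysics.QuantumFieldTheory.Balaban1983to89.T4Continuum.FiniteEpsData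

variable {F : T4Family} {N : ℕ} [NeZero N]

/-- **FOR DATA IN THE HEADLINE'S ONE-LEVEL PRINTED CLASS** (`D.IsPrintedAveraged₁`): `HolDevBound` for the datum's OWN averaging maps
`D.av K` at every cutoff `K`, rate `θ = L^{1−d}`, constant `e`, ON THE LEVEL-FREE TV-BALLS `domTV` (radius `τ⋆`, the same at every
level; no `m`-dependence). [folklore] -/
theorem holDevBound_of_isPrintedAveraged₁_tv (D : FiniteEpsData F (Matrix.specialUnitaryGroup (Fin N) ℂ))
    (hD : D.IsPrintedAveraged₁) (K : ℕ) :
    HolDevBound (D.av K) (domTV (F.P K) (Fin N)) (Real.exp 1) (theta (F.P K)) := by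
  have h : D.av K = fun j => blockAvg (expMeanLogSU (n := Fin N)) := funext fun j => hD K j
  rw [h]
  exact holDevBound_blockAvgSU_tv

/-- … and `LoopDefectBound` (constant `e²/2`) likewise. [folklore] -/
theorem loopDefectBound_of_isPrintedAveraged₁_tv (D : FiniteEpsData F (Matrix.specialUnitaryGroup (Fin N) ℂ))
    (hD : D.IsPrintedAveraged₁) (K : ℕ) :
    LoopDefectBound (D.av K) (domTV (F.P K) (Fin N)) (1 / 2 * Real.exp 1 ^ 2) (theta (F.P K)) := by
  have h : D.av K = fun j => blockAvg (expMeanLogSU (n := Fin N)) := funext fun j => hD K j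
  rw [h]
  exact loopDefectBound_blockAvgSU_tv

end Headline

end Summit.QuantumFields.BalabanUV.T4Continuum.Spine.NE7

end
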